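import Summits.ResolutionOfSingularities.ResolutionOfSingularities.Theorems.FrobeniusLadderFInjectiveMacaulayficationToricChartFedder
import Mathlib.RingTheory.MvPolynomial.WeightedHomogeneous
import Mathlib.Data.Matrix.Mul
import Mathlib.Data.Fin.VecNotation
import HarnessLib

/-!
# Q6CN KIT — generic transfer lemmas turning the decidable side conditions of `CNConeFiModelPrime.cnConeFiModel_of_isPrime`
# into `decide`-able identities of `Fin n → ℕ` vectors (crux `FInjectiveMacaulayfication`, calibration `stub_q6CNFiModel_char5`;
# CRUX-PLAN v7 R7.3′, seat res-L1-w45a-stub-3 = Q6CN typer)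

Support file for crux stmt-ResolutionOfSingularities-15315. [OURS · L1 W4.5a] — NOT a statement of the manuscript; AI-written,
weaker than expert review.

The CN engine's data (`A`, `V_c`, `m_c`, `a_c`, cover witnesses, `d_c`, `g_c`, faces) are exponent VECTORS. The script-generated
specimen files state them as `Finsupp.equivFunOnFinite.symm ![…]` and discharge every hypothesis by ONE of the lemmas below, whose own
hypotheses are identities / inequalities of `Fin n → ℕ` literals closed by `decide`:

* `symm_injective`, `mem_image_symm` — membership in `A = (AL.map symm).toFinset`; `zero_not_mem`, `single_mem`;
* `hgen_of_vec`, `hge_of_vec` — (hgen) and (h≥) from vector identities with `Matrix.mulVec`;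
* `monomial_symm_pow_eq`, `cover_witness` — a cover identity `(x^e)^K = x^m · (x^r · ∏ x^(bᵢ))` with `∏ x^(bᵢ) ∈ I_A^(K-1)` from the
  vector identity `K • e = m + r + Σ bᵢ` and `bᵢ ∈ AL`;
* `sumMonomials` facts: `coeff_sumMonomials`, `mem_support_sumMonomials`, `weightedHomogeneousComponent_sumMonomials`,
  `weight_symm`, `component_ne_zero_imp_le`, `component_pin` — for polynomials written as `Σ_(e ∈ EL) x^e` over a duplicate-free
  list of exponent vectors: support, coefficients, weighted components as filtered sub-sums, and the pinning of the initial degree;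
* `theta_sumMonomials` — the chart map `θ_V` on such a sum and the factorisation `θ f = x^d · g` from `V e = d + g_e`;
* `not_X_dvd_sumMonomials` — `¬ Xᵢ ∣ g` from one exponent with `i`-th entry `0`.

No definitions (the «sum of monomials over a list» is written out each time), no named facts. [folklore]
-/

-- single-problem summit: the doubled namespace component is forced
set_option linter.dupNamespace false

noncomputable section

namespace Summit.ResolutionOfSingularities.ResolutionOfSingularities.Theorems.FInjectiveMacaulayfication.Q6CNKit

open Summit.ResolutionOfSingularities.ResolutionOfSingularities.Theorems.FInjectiveMacaulayfication

variable {n : ℕ}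

/-! ## Exponent vectors -/

/-- `Finsupp.equivFunOnFinite.symm` is injective. [folklore] -/
theorem symm_injective : Function.Injective (fun v : Fin n → ℕ => (Finsupp.equivFunOnFinite.symm v : Fin n →₀ ℕ)) :=
  Finsupp.equivFunOnFinite.symm.injective

/-- `symm` is additive. [folklore] -/
theorem symm_add (u v : Fin n → ℕ) :
    (Finsupp.equivFunOnFinite.symm (u + v) : Fin n →₀ ℕ) = Finsupp.equivFunOnFinite.symm u + Finsupp.equivFunOnFinite.symm v := by
  ext i; rfl

/-- `symm` commutes with scalar multiples. [folklore] -/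
theorem symm_nsmul (K : ℕ) (u : Fin n → ℕ) :
    (Finsupp.equivFunOnFinite.symm (K • u) : Fin n →₀ ℕ) = K • Finsupp.equivFunOnFinite.symm u := by
  ext i; rfl

/-- Membership in the generator set `A = AL.map symm`. [folklore] -/
theorem mem_image_symm (AL : List (Fin n → ℕ)) (v : Fin n → ℕ) :
    (Finsupp.equivFunOnFinite.symm v : Fin n →₀ ℕ) ∈ (AL.map fun u => (Finsupp.equivFunOnFinite.symm u : Fin n →₀ ℕ)).toFinset ↔
      v ∈ AL := by
  rw [List.mem_toFinset, List.mem_map]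
  constructor
  · rintro ⟨u, hu, huv⟩
    rwa [← symm_injective huv]
  · exact fun hv => ⟨v, hv, rfl⟩

/-- Elements of `A` are of the form `symm v`, `v ∈ AL`. [folklore] -/
theorem exists_of_mem_image_symm (AL : List (Fin n → ℕ)) (e : Fin n →₀ ℕ)
    (he : e ∈ (AL.map fun u => (Finsupp.equivFunOnFinite.symm u : Fin n →₀ ℕ)).toFinset) :
    ∃ v ∈ AL, e = Finsupp.equivFunOnFinite.symm v := by
  rw [List.mem_toFinset, List.mem_map] at he
  obtain ⟨v, hv, rfl⟩ := he
  exact ⟨v, hv, rfl⟩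

/-- `0 ∉ A` from `0 ∉ AL`. [folklore] -/
theorem zero_not_mem (AL : List (Fin n → ℕ)) (h0 : (0 : Fin n → ℕ) ∉ AL) :
    (0 : Fin n →₀ ℕ) ∉ (AL.map fun u => (Finsupp.equivFunOnFinite.symm u : Fin n →₀ ℕ)).toFinset := by
  have h : (0 : Fin n →₀ ℕ) = Finsupp.equivFunOnFinite.symm (0 : Fin n → ℕ) := by ext i; rfl
  rw [h, mem_image_symm]
  exact h0

/-- A pure power `X_j^e ∈ A` from `Pi.single j e ∈ AL`. [folklore] -/
theorem single_mem (AL : List (Fin n → ℕ)) (j : Fin n) (e : ℕ) (h : (Pi.single j e : Fin n → ℕ) ∈ AL) :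
    Finsupp.single j e ∈ (AL.map fun u => (Finsupp.equivFunOnFinite.symm u : Fin n →₀ ℕ)).toFinset := by
  have hs : (Finsupp.single j e : Fin n →₀ ℕ) = Finsupp.equivFunOnFinite.symm (Pi.single j e : Fin n → ℕ) := by
    ext i; rw [Finsupp.single_apply, Finsupp.coe_equivFunOnFinite_symm, Pi.single_apply]; simp only [eq_comm]
  rw [hs, mem_image_symm]
  exact h

/-! ## (hgen) and (h≥) -/

/-- **(hgen) from a vector identity.** [folklore] -/
theorem hgen_of_vec (V : Matrix (Fin n) (Fin n) ℕ) (a m : Fin n → ℕ) (i : Fin n)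
    (h : V.mulVec a = V.mulVec m + Pi.single i 1) :
    (Finsupp.equivFunOnFinite.symm (V.mulVec ⇑(Finsupp.equivFunOnFinite.symm a : Fin n →₀ ℕ)) : Fin n →₀ ℕ) =
      Finsupp.equivFunOnFinite.symm (V.mulVec ⇑(Finsupp.equivFunOnFinite.symm m : Fin n →₀ ℕ)) + Finsupp.single i 1 := by
  ext l
  rw [Finsupp.add_apply, Finsupp.coe_equivFunOnFinite_symm, Finsupp.coe_equivFunOnFinite_symm, Finsupp.coe_equivFunOnFinite_symm,
    Finsupp.coe_equivFunOnFinite_symm, h, Pi.add_apply, Finsupp.single_apply, Pi.single_apply]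
  simp only [eq_comm]

/-- **(h≥) from vector inequalities over the generator list.** [folklore] -/
theorem hge_of_vec (V : Matrix (Fin n) (Fin n) ℕ) (AL : List (Fin n → ℕ)) (m : Fin n → ℕ)
    (h : ∀ v ∈ AL, ∀ i : Fin n, V.mulVec m i ≤ V.mulVec v i) :
    ∀ e ∈ (AL.map fun u => (Finsupp.equivFunOnFinite.symm u : Fin n →₀ ℕ)).toFinset,
      (Finsupp.equivFunOnFinite.symm (V.mulVec ⇑(Finsupp.equivFunOnFinite.symm m : Fin n →₀ ℕ)) : Fin n →₀ ℕ) ≤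
        Finsupp.equivFunOnFinite.symm (V.mulVec ⇑e) := by
  intro e he
  obtain ⟨v, hv, rfl⟩ := exists_of_mem_image_symm AL e he
  intro i
  rw [Finsupp.coe_equivFunOnFinite_symm, Finsupp.coe_equivFunOnFinite_symm, Finsupp.coe_equivFunOnFinite_symm,
    Finsupp.coe_equivFunOnFinite_symm]
  exact h v hv i

/-! ## Cover witnesses -/

/-- A monomial identity from a vector identity: `(x^e)^K = x^m · x^s` when `K • e = m + s`. [folklore] -/
theorem monomial_symm_pow_eq {k : Type} [CommSemiring k] (K : ℕ) (e m s : Fin n → ℕ) (h : K • e = m + s) :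
    (MvPolynomial.monomial (Finsupp.equivFunOnFinite.symm e) (1 : k) : MvPolynomial (Fin n) k) ^ K =
      MvPolynomial.monomial (Finsupp.equivFunOnFinite.symm m) 1 * MvPolynomial.monomial (Finsupp.equivFunOnFinite.symm s) 1 := by
  rw [MvPolynomial.monomial_pow, one_pow, MvPolynomial.monomial_mul, mul_one, ← symm_nsmul, h, symm_add]

/-- A product of monomials over a list is the monomial of the sum. [folklore] -/
theorem prod_monomial_symm {k : Type} [CommSemiring k] (B : List (Fin n → ℕ)) :
    (B.map fun b => (MvPolynomial.monomial (Finsupp.equivFunOnFinite.symm b) (1 : k) : MvPolynomial (Fin n) k)).prod =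
      MvPolynomial.monomial (Finsupp.equivFunOnFinite.symm B.sum) 1 := by
  induction B with
  | nil =>
    rw [List.map_nil, List.prod_nil, List.sum_nil]
    have h : (Finsupp.equivFunOnFinite.symm (0 : Fin n → ℕ) : Fin n →₀ ℕ) = 0 := by ext i; rfl
    rw [h, MvPolynomial.monomial_zero', MvPolynomial.C_1]
  | cons b B ih =>
    rw [List.map_cons, List.prod_cons, List.sum_cons, ih, MvPolynomial.monomial_mul, one_mul, symm_add]

/-- A product over a list of elements of `I` of length `L` lies in `I^L`. [folklore] -/
theorem list_prod_mem_pow {R : Type} [CommSemiring R] (I : Ideal R) (l : List R) (h : ∀ x ∈ l, x ∈ I) :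
    l.prod ∈ I ^ l.length := by
  induction l with
  | nil => rw [List.prod_nil, List.length_nil, pow_zero, Ideal.one_eq_top]; exact Submodule.mem_top
  | cons x l ih =>
    rw [List.prod_cons, List.length_cons, pow_succ']
    exact Ideal.mul_mem_mul (h x (by simp)) (ih fun y hy => h y (by simp [hy]))

/-- **COVER WITNESS from a vector identity**: if `K • e = m + r + Σ B` with every `b ∈ B` in the generator list `AL` and
`K = |B| + 1`, then `(x^e)^K = x^m · y` with `y = x^r · ∏_(b ∈ B) x^b ∈ I_A^(K-1)`. [folklore] -/
theorem cover_witness {k : Type} [Field k] (AL : List (Fin n → ℕ)) (e m r : Fin n → ℕ) (B : List (Fin n → ℕ))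
    (hB : ∀ b ∈ B, b ∈ AL) (hid : (B.length + 1) • e = m + (r + B.sum)) :
    ∃ (K : ℕ), 1 ≤ K ∧ ∃ y ∈ (Ideal.span ((fun b : Fin n →₀ ℕ => (MvPolynomial.monomial b (1 : k) : MvPolynomial (Fin n) k)) ''
        ((AL.map fun u => (Finsupp.equivFunOnFinite.symm u : Fin n →₀ ℕ)).toFinset : Set (Fin n →₀ ℕ)))) ^ (K - 1),
      (MvPolynomial.monomial (Finsupp.equivFunOnFinite.symm e) (1 : k) : MvPolynomial (Fin n) k) ^ K =
        MvPolynomial.monomial (Finsupp.equivFunOnFinite.symm m) 1 * y := by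
  refine ⟨B.length + 1, by omega, MvPolynomial.monomial (Finsupp.equivFunOnFinite.symm r) 1 *
    (B.map fun b => (MvPolynomial.monomial (Finsupp.equivFunOnFinite.symm b) (1 : k) : MvPolynomial (Fin n) k)).prod, ?_, ?_⟩
  · rw [Nat.add_sub_cancel]
    have hlen : (B.map fun b => (MvPolynomial.monomial (Finsupp.equivFunOnFinite.symm b) (1 : k) : MvPolynomial (Fin n) k)).length =
        B.length := List.length_map _
    rw [← hlen]
    refine Ideal.mul_mem_left _ _ (list_prod_mem_pow _ _ fun x hx => ?_)
    rw [List.mem_map] at hx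
    obtain ⟨b, hb, rfl⟩ := hx
    exact Ideal.subset_span ⟨_, (mem_image_symm AL b).mpr (hB b hb), rfl⟩
  · rw [prod_monomial_symm, MvPolynomial.monomial_mul, one_mul, ← symm_add]
    exact monomial_symm_pow_eq _ e m (r + B.sum) hid

/-! ## Sums of monomials over a list of exponents -/

/-- Coefficients of `Σ_(e ∈ EL) x^e` for a duplicate-free list. [folklore] -/
theorem coeff_sumMonomials {k : Type} [CommSemiring k] (EL : List (Fin n → ℕ)) (hEL : EL.Nodup) (v : Fin n → ℕ) :
    MvPolynomial.coeff (Finsupp.equivFunOnFinite.symm v)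
      ((EL.map fun e => (MvPolynomial.monomial (Finsupp.equivFunOnFinite.symm e) (1 : k) : MvPolynomial (Fin n) k)).sum) =
      if v ∈ EL then 1 else 0 := by
  classical
  induction EL with
  | nil => simp
  | cons e EL ih =>
    rw [List.map_cons, List.sum_cons, MvPolynomial.coeff_add, ih (List.nodup_cons.mp hEL).2, MvPolynomial.coeff_monomial]
    by_cases hve : v = e
    · subst hve
      have hv : v ∉ EL := (List.nodup_cons.mp hEL).1
      simp [hv]
    · have hne : (Finsupp.equivFunOnFinite.symm e : Fin n →₀ ℕ) ≠ Finsupp.equivFunOnFinite.symm v :=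
        fun h => hve (symm_injective h).symm
      simp [hne, hve]

/-- Support membership of `Σ_(e ∈ EL) x^e`. [folklore] -/
theorem mem_support_sumMonomials {k : Type} [Field k] (EL : List (Fin n → ℕ)) (hEL : EL.Nodup) (v : Fin n → ℕ)
    (hv : v ∈ EL) :
    (Finsupp.equivFunOnFinite.symm v : Fin n →₀ ℕ) ∈
      ((EL.map fun e => (MvPolynomial.monomial (Finsupp.equivFunOnFinite.symm e) (1 : k) : MvPolynomial (Fin n) k)).sum).support := by
  rw [MvPolynomial.mem_support_iff, coeff_sumMonomials EL hEL, if_pos hv]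
  exact one_ne_zero

/-- The support of `Σ_(e ∈ EL) x^e` consists of the `symm e`, `e ∈ EL`. [folklore] -/
theorem exists_of_mem_support_sumMonomials {k : Type} [CommSemiring k] (EL : List (Fin n → ℕ)) (hEL : EL.Nodup)
    (d : Fin n →₀ ℕ)
    (hd : d ∈ ((EL.map fun e => (MvPolynomial.monomial (Finsupp.equivFunOnFinite.symm e) (1 : k) :
      MvPolynomial (Fin n) k)).sum).support) :
    ∃ v ∈ EL, d = Finsupp.equivFunOnFinite.symm v := by
  have hd' : d = Finsupp.equivFunOnFinite.symm (⇑d) := (Finsupp.equivFunOnFinite.symm_apply_apply d).symm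
  rw [hd', MvPolynomial.mem_support_iff, coeff_sumMonomials EL hEL] at hd
  by_cases h : (⇑d : Fin n → ℕ) ∈ EL
  · exact ⟨_, h, hd'⟩
  · rw [if_neg h] at hd
    exact absurd rfl hd

/-- The weight of `symm v` is the dot product. [folklore] -/
theorem weight_symm (w v : Fin n → ℕ) :
    Finsupp.weight w (Finsupp.equivFunOnFinite.symm v : Fin n →₀ ℕ) = ∑ j : Fin n, v j * w j := by
  rw [Finsupp.weight_apply, Finsupp.sum_fintype _ _ (fun i => by simp)]
  simp only [Finsupp.coe_equivFunOnFinite_symm, smul_eq_mul]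

/-- **Weighted components of `Σ_(e ∈ EL) x^e`** are the filtered sub-sums. [folklore] -/
theorem weightedHomogeneousComponent_sumMonomials {k : Type} [CommSemiring k] (w : Fin n → ℕ) (D : ℕ) (EL : List (Fin n → ℕ)) :
    MvPolynomial.weightedHomogeneousComponent w D
      ((EL.map fun e => (MvPolynomial.monomial (Finsupp.equivFunOnFinite.symm e) (1 : k) : MvPolynomial (Fin n) k)).sum) =
      ((EL.filter fun e => ∑ j : Fin n, e j * w j = D).map fun e =>
        (MvPolynomial.monomial (Finsupp.equivFunOnFinite.symm e) (1 : k) : MvPolynomial (Fin n) k)).sum := by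
  classical
  induction EL with
  | nil => simp
  | cons e EL ih =>
    rw [List.map_cons, List.sum_cons, map_add, ih, List.filter_cons]
    have hmon : MvPolynomial.weightedHomogeneousComponent w D
        (MvPolynomial.monomial (Finsupp.equivFunOnFinite.symm e) (1 : k) : MvPolynomial (Fin n) k) =
        if ∑ j : Fin n, e j * w j = D then MvPolynomial.monomial (Finsupp.equivFunOnFinite.symm e) 1 else 0 := by
      rw [MvPolynomial.weightedHomogeneousComponent_of_mem (MvPolynomial.isWeightedHomogeneous_monomial w _ _ rfl), weight_symm]
      by_cases h : ∑ j : Fin n, e j * w j = D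
      · rw [if_pos h, if_pos h.symm]
      · rw [if_neg h, if_neg (fun h' => h h'.symm)]
    rw [hmon]
    by_cases h : ∑ j : Fin n, e j * w j = D
    · rw [if_pos h, decide_eq_true h]
      simp
    · rw [if_neg h, decide_eq_false h]
      simp

/-- **A non-zero weighted component has degree ≥ the least weight of the list.** [folklore] -/
theorem component_ne_zero_imp_le {k : Type} [CommSemiring k] (w : Fin n → ℕ) (D D₀ : ℕ) (EL : List (Fin n → ℕ))
    (hmin : ∀ e ∈ EL, D₀ ≤ ∑ j : Fin n, e j * w j)
    (hD : MvPolynomial.weightedHomogeneousComponent w D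
      ((EL.map fun e => (MvPolynomial.monomial (Finsupp.equivFunOnFinite.symm e) (1 : k) : MvPolynomial (Fin n) k)).sum) ≠ 0) :
    D₀ ≤ D := by
  rw [weightedHomogeneousComponent_sumMonomials] at hD
  by_contra hlt
  apply hD
  have hnil : (EL.filter fun e => ∑ j : Fin n, e j * w j = D) = [] := by
    rw [List.filter_eq_nil_iff]
    intro e he h
    have h1 := hmin e he
    rw [decide_eq_true_eq] at h
    omega
  rw [hnil, List.map_nil, List.sum_nil]

/-- **Pinning the initial degree**: the binder `component D f ≠ 0 ∧ ∀ D' < D, component D' f = 0` forces `D = D₀` once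
`component D₀ f ≠ 0` and every exponent has weight `≥ D₀`. [folklore] -/
theorem component_pin {k : Type} [CommSemiring k] (w : Fin n → ℕ) (D D₀ : ℕ) (EL : List (Fin n → ℕ))
    (hmin : ∀ e ∈ EL, D₀ ≤ ∑ j : Fin n, e j * w j)
    (hD₀ : MvPolynomial.weightedHomogeneousComponent w D₀
      ((EL.map fun e => (MvPolynomial.monomial (Finsupp.equivFunOnFinite.symm e) (1 : k) : MvPolynomial (Fin n) k)).sum) ≠ 0)
    (hD : MvPolynomial.weightedHomogeneousComponent w D
      ((EL.map fun e => (MvPolynomial.monomial (Finsupp.equivFunOnFinite.symm e) (1 : k) : MvPolynomial (Fin n) k)).sum) ≠ 0 ∧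
      ∀ D' < D, MvPolynomial.weightedHomogeneousComponent w D'
        ((EL.map fun e => (MvPolynomial.monomial (Finsupp.equivFunOnFinite.symm e) (1 : k) : MvPolynomial (Fin n) k)).sum) = 0) :
    D = D₀ := by
  have h1 := component_ne_zero_imp_le w D D₀ EL hmin hD.1
  rcases Nat.lt_or_ge D₀ D with h | h
  · exact absurd (hD.2 D₀ h) hD₀
  · omega

/-! ## The chart map and divisibility -/

/-- **`θ_V` on a sum of monomials, factored**: if `V e = d + g_e` for every `e ∈ EL` then
`θ_V (Σ x^e) = x^d · Σ x^(g_e)`. [folklore] -/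
theorem theta_sumMonomials {k : Type} [CommRing k] (V : Matrix (Fin n) (Fin n) ℕ) (EL : List (Fin n → ℕ)) (d : Fin n → ℕ)
    (ge : (Fin n → ℕ) → (Fin n → ℕ)) (h : ∀ e ∈ EL, V.mulVec e = d + ge e) :
    MvPolynomial.aeval (fun j : Fin n => ∏ i : Fin n, (MvPolynomial.X i : MvPolynomial (Fin n) k) ^ V i j)
      ((EL.map fun e => (MvPolynomial.monomial (Finsupp.equivFunOnFinite.symm e) (1 : k) : MvPolynomial (Fin n) k)).sum) =
      MvPolynomial.monomial (Finsupp.equivFunOnFinite.symm d) 1 *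
        ((EL.map fun e => (MvPolynomial.monomial (Finsupp.equivFunOnFinite.symm (ge e)) (1 : k) : MvPolynomial (Fin n) k)).sum) := by
  induction EL with
  | nil => simp
  | cons e EL ih =>
    rw [List.map_cons, List.sum_cons, map_add, ih (fun e' he' => h e' (by simp [he'])), List.map_cons, List.sum_cons, mul_add,
      ToricChartFedder.theta_monomial, MvPolynomial.monomial_mul, one_mul, Finsupp.coe_equivFunOnFinite_symm, h e (by simp),
      symm_add]

/-- **`¬ Xᵢ ∣ Σ x^e`** as soon as some exponent `e ∈ EL` has `e i = 0` (duplicate-free list). [folklore] -/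
theorem not_X_dvd_sumMonomials {k : Type} [Field k] (EL : List (Fin n → ℕ)) (hEL : EL.Nodup) (i : Fin n) (e : Fin n → ℕ)
    (he : e ∈ EL) (hei : e i = 0) :
    ¬ (MvPolynomial.X i : MvPolynomial (Fin n) k) ∣
      ((EL.map fun e => (MvPolynomial.monomial (Finsupp.equivFunOnFinite.symm e) (1 : k) : MvPolynomial (Fin n) k)).sum) := by
  rintro ⟨q, hq⟩
  have hc := coeff_sumMonomials (k := k) EL hEL e
  rw [if_pos he, hq, MvPolynomial.coeff_X_mul'] at hc
  have hmem : i ∉ (Finsupp.equivFunOnFinite.symm e : Fin n →₀ ℕ).support := by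
    rw [Finsupp.mem_support_iff, Finsupp.coe_equivFunOnFinite_symm, hei]; exact fun h => h rfl
  rw [if_neg hmem] at hc
  exact one_ne_zero hc.symm

end Summit.ResolutionOfSingularities.ResolutionOfSingularities.Theorems.FInjectiveMacaulayfication.Q6CNKit

end
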